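import Summits.NavierStokesRegularity.NavierStokesRegularity.Theorems.ScenarioCensusTemporalSpectrumQuasiGroup
import Summits.NavierStokesRegularity.NavierStokesRegularity.Theorems.ScenarioCensusModeRankShell
import HarnessLib

/-!
# LINE «temporal-spectrum» port, part 11/12: §Q (d) — `row_A1qx_holds`, nestings `row_A1cs_of_row_A1qx` / `row_A1jb_of_row_A1qx`, bookkeeping

Re-homed for the scenario census (typer seat ns-census-typer-1 g8; the cells A1ex / A1po are MEMBERS OF RECORD «DECIDED IN KERNEL IN FILES» of row A1apT since census
v1.69 and A1jb / A1cs / A1qx / A1cx since v1.71 (critic idea-crit-3 g6 PASS — no price 20:33:05Z, RE-STAMPs REV 2 → REV 3 → REV 4 22:13:50Z; ref ns-census-ref g8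
PRE-CHECK ✓ §13.14 item 11 + items 19/20; lit §21.21 / §21.24 (a)); this port makes them TREE-decided): VERBATIM PORT of ns-idea-2 LINE g12-2 «temporal-spectrum»
REV 4, `pub/ideators/ns-idea-2/lines/temporal-spectrum/line-temporal-spectrum.lean` sha16 f2331f3a0765e1d4 (3431 l., lean check rc 0, 0 sorry), split for the
400-line rule into twelve parts `ScenarioCensusTemporalSpectrum{∅, Exponential, Oscillatory, OscillatoryRow, Jordan, Complex, ComplexDecay, ComplexRow, Quasi, QuasiGroup,
QuasiRow, Head}` (chain imports).  Lean text VERBATIM in namespace `…Theorems.ScenarioCensus.TemporalSpectrum` (the line's `…Lines.TemporalSpectrum` re-homed);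
port edits: the two `local notation "E3"` lines → one `abbrev E3` at namespace level and the bracket lines `section Rows` / `end Rows` dropped (no `variable`s
there; typer lint: no notation in port files), `@[conjecture]` on the OPEN head `Row_A1qp` (typed only), twenty-one one-line docstrings added (gate lint); the
lemmas the line shares VERBATIM with «mode-rank» / «floquet-meter» (§B spatial Liouville lemmas, the instrument `vortB` / `vortB_sum_sum`, the gauge
`tendsto_slice_atBot` / `eq_zero_of_curl_slice_const`, `laplacian_zero_apply`, `norm_curl_le_four_mul`) are taken BY NAME from those landed ports (listed
below); `tendsto_typeI_bound` (twin of a landed tree lemma in a module the farm does not build) is not re-declared and its four uses carry the one-line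
Mathlib proof inline (proof text only).  Statements untouched.

No census VALUE is moved here (row A1apT keeps its value; the members become TREE-decided by name); NS regularity is NOT proved; (L′) ⟨10661⟩ is
untouched; no summit statement is proved by this file. Lemmas that restate already-landed tree declarations are taken BY NAME (gate lint `dedup.landed`): `apply_eq_apply_of_harmonic_bounded` = `ModeRank.apply_eq_apply_of_harmonic_bounded`, `apply_eq_apply_of_curl_const` = `ModeRank.apply_eq_apply_of_curl_const`, `nonpos_of_laplacian_eq_mul` = `ModeRank.nonpos_of_laplacian_eq_mul`, `eq_zero_of_laplacian_eq_smul_of_pos` = `ModeRank.eq_zero_of_laplacian_eq_smul_of_pos`, `vortB` = `ModeRank.vortB`, `vortB_sum_sum` = `ModeRank.vortB_sum_sum`, `tendsto_slice_atBot` = `ModeRank.tendsto_slice_atBot`, `eq_zero_of_curl_slice_const` = `ModeRank.eq_zero_of_curl_slice_const`, `laplacian_zero_apply` = `ModeRank.laplacian_zero_fun`, `norm_curl_le_four_mul` = `FloquetMeter.norm_curl_le_four_mul`.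
-/

-- the summit and its single problem share the name `NavierStokesRegularity` (D-0017 nested layout)
set_option linter.dupNamespace false

noncomputable section

open Set Function Filter Topology

namespace Summit.NavierStokesRegularity.NavierStokesRegularity.Theorems.ScenarioCensus.TemporalSpectrum

open Literature.Analysis Literature.Analysis.FluidPDE InnerProductSpace
open Summit.NavierStokesRegularity.NavierStokesRegularity.Theorems (vorticity_eq_deriv_of_typeI)
open scoped Laplacian InnerProductSpace RealInnerProductSpace ContDiff

/-- **Row A1qx holds.** -/
theorem row_A1qx_holds : Row_A1qx := by
  classical
  intro C u hu n d a b ψ χ hb0 hinj hψ hχ hbψ hbχ hsl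
  -- ### Step 0: truncate the coefficient families at level `d`
  set Ψ : Fin n → ℕ → E3 → E3 := fun k m => if m < d then ψ k m else 0 with hΨdef
  set Χ : Fin n → ℕ → E3 → E3 := fun k m => if m < d then χ k m else 0 with hΧdef
  have hΨeq : ∀ k, ∀ m < d, Ψ k m = ψ k m := fun k m hm => by simp [hΨdef, hm]
  have hΧeq : ∀ k, ∀ m < d, Χ k m = χ k m := fun k m hm => by simp [hΧdef, hm]
  have hΨd : ∀ k m, d ≤ m → Ψ k m = 0 := fun k m hm => by simp [hΨdef, not_lt.2 hm]
  have hΧd : ∀ k m, d ≤ m → Χ k m = 0 := fun k m hm => by simp [hΧdef, not_lt.2 hm]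
  have hΨr : ∀ k m, ContDiff ℝ 3 (Ψ k m) := by
    intro k m
    by_cases hm : m < d
    · rw [hΨeq k m hm]; exact hψ k m
    · rw [hΨd k m (not_lt.1 hm)]; exact contDiff_const
  have hΧr : ∀ k m, ContDiff ℝ 3 (Χ k m) := by
    intro k m
    by_cases hm : m < d
    · rw [hΧeq k m hm]; exact hχ k m
    · rw [hΧd k m (not_lt.1 hm)]; exact contDiff_const
  have hcurl0 : curl (0 : E3 → E3) = 0 := funext fun y => curl_zero y
  have hbΨ : ∀ k m, ∃ A : ℝ, ∀ x, ‖curl (Ψ k m) x‖ ≤ A := by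
    intro k m
    by_cases hm : m < d
    · rw [hΨeq k m hm]; exact hbψ k m
    · rw [hΨd k m (not_lt.1 hm), hcurl0]; exact ⟨0, fun x => by simp⟩
  have hbΧ : ∀ k m, ∃ A : ℝ, ∀ x, ‖curl (Χ k m) x‖ ≤ A := by
    intro k m
    by_cases hm : m < d
    · rw [hΧeq k m hm]; exact hbχ k m
    · rw [hΧd k m (not_lt.1 hm), hcurl0]; exact ⟨0, fun x => by simp⟩
  have hsl' : ∀ s < 0, ∀ y, u s y = ∑ p, qc d a b s p • qΦ d Ψ Χ p y := by
    intro s hs y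
    rw [hsl s hs y, Fintype.sum_prod_type, Fintype.sum_sum_type, ← Finset.sum_add_distrib]
    refine Finset.sum_congr rfl fun k _ => ?_
    have e1 : ∑ m : Fin d, qc d a b s (Sum.inl k, m) • qΦ d Ψ Χ (Sum.inl k, m) y
        = ∑ m ∈ Finset.range d, (Real.exp (a k * s) * (s ^ m * Real.cos (b k * s))) • Ψ k m y :=
      Fin.sum_univ_eq_sum_range
        (fun m => (Real.exp (a k * s) * (s ^ m * Real.cos (b k * s))) • Ψ k m y) d
    have e2 : ∑ m : Fin d, qc d a b s (Sum.inr k, m) • qΦ d Ψ Χ (Sum.inr k, m) y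
        = ∑ m ∈ Finset.range d, (Real.exp (a k * s) * (s ^ m * Real.sin (b k * s))) • Χ k m y :=
      Fin.sum_univ_eq_sum_range
        (fun m => (Real.exp (a k * s) * (s ^ m * Real.sin (b k * s))) • Χ k m y) d
    rw [e1, e2, ← Finset.sum_add_distrib]
    refine Finset.sum_congr rfl fun m hm => ?_
    rw [hΨeq k m (Finset.mem_range.1 hm), hΧeq k m (Finset.mem_range.1 hm), smul_add, smul_smul,
      smul_smul]
    congr 1 <;> ring_nf
  have hdΦ : ∀ p, Differentiable ℝ (qΦ d Ψ Χ p) := by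
    rintro ⟨k | k, m⟩
    · exact (hΨr k m).differentiable (by norm_num)
    · exact (hΧr k m).differentiable (by norm_num)
  have hsin0 : ∀ k (m : Fin d), b k = 0 → ∀ s, qc d a b s (Sum.inr k, m) = 0 := by
    intro k m hk s; simp [qc_apply, csT_inr, hk]
  -- Steps 1 and 2
  have hdec := q_decay hu hb0 hinj hsl'
  have hE := q_identity hu hΨr hΧr hsl'
  -- ### Step 3: no mode carries vorticity (Jordan descent at the minimal carrying real part)
  have hcar : ∀ k, ∀ m < d, curl (Ψ k m) = 0 ∧ (b k ≠ 0 → curl (Χ k m) = 0) := by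
    by_contra hcon
    obtain ⟨k₁, hk₁⟩ := not_forall.1 hcon
    set S : Finset (Fin n) := Finset.univ.filter
      (fun k => ¬ ∀ m < d, curl (Ψ k m) = 0 ∧ (b k ≠ 0 → curl (Χ k m) = 0)) with hS
    have hSne : S.Nonempty :=
      ⟨k₁, by simp only [hS, Finset.mem_filter, Finset.mem_univ, true_and]; exact hk₁⟩
    obtain ⟨ks, hksS, hmin⟩ := S.exists_min_image a hSne
    have hks : ¬ ∀ m < d, curl (Ψ ks m) = 0 ∧ (b ks ≠ 0 → curl (Χ ks m) = 0) :=
      (Finset.mem_filter.1 hksS).2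
    have hlow : ∀ k, a k < a ks → ∀ m < d, curl (Ψ k m) = 0 ∧ (b k ≠ 0 → curl (Χ k m) = 0) := by
      intro k hk
      by_contra hk'
      have hkS : k ∈ S := by
        simp only [hS, Finset.mem_filter, Finset.mem_univ, true_and]
        exact hk'
      exact absurd (hmin k hkS) (not_le.2 hk)
    have hpos : 0 < a ks := by
      by_contra hle
      push Not at hle
      apply hks
      intro m hm
      obtain ⟨h1, h2⟩ := hdec ks hle m hm
      refine ⟨?_, fun hb => ?_⟩
      · have h0 : Ψ ks m = 0 := funext h1
        rw [h0, hcurl0]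
      · have h0 : Χ ks m = 0 := funext (h2 hb)
        rw [h0, hcurl0]
    have hgrp := q_group_tendsto hΨd hΧd hdec hlow hE
    have hInj : Set.InjOn b ↑(Finset.univ.filter (fun k => a k = a ks)) := by
      intro k hk k' hk' hbb
      simp only [Finset.coe_filter, Finset.mem_univ, true_and, Set.mem_setOf_eq] at hk hk'
      exact hinj (Prod.ext (by simp [hk, hk']) hbb)
    have hksmem : ks ∈ Finset.univ.filter (fun k => a k = a ks) := by simp
    have key : ∀ z, ∀ m < d, qX a b Ψ Χ z ks m = 0 ∧ (b ks ≠ 0 → qY a b Ψ Χ z ks m = 0) :=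
      fun z => quasiPoly_coeff_eq_zero (Finset.univ.filter (fun k => a k = a ks)) b
        (fun k _ => hb0 k) hInj d (qX a b Ψ Χ z) (qY a b Ψ Χ z) (hgrp z) ks hksmem
    have hcΨ : ∀ m, ContDiff ℝ 2 (curl (Ψ ks m)) := fun m => contDiff_curl (hΨr ks m)
    have hcΧ : ∀ m, ContDiff ℝ 2 (curl (Χ ks m)) := fun m => contDiff_curl (hΧr ks m)
    -- JORDAN DESCENT from the top power
    have hdesc : ∀ j, j ≤ d → curl (Ψ ks (d - j)) = 0 ∧ (b ks ≠ 0 → curl (Χ ks (d - j)) = 0) := by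
      intro j
      induction j with
      | zero =>
        intro _
        rw [Nat.sub_zero, hΨd ks d le_rfl, hΧd ks d le_rfl, hcurl0]
        exact ⟨rfl, fun _ => rfl⟩
      | succ j ih =>
        intro hj
        have ih' := ih (Nat.le_of_succ_le hj)
        have hm : d - (j + 1) < d := by omega
        have hm1 : d - (j + 1) + 1 = d - j := by omega
        have kX : ∀ z, (Δ (curl (Ψ ks (d - (j + 1))))) z
            = a ks • curl (Ψ ks (d - (j + 1))) z + b ks • curl (Χ ks (d - (j + 1))) z := by
          intro z
          have h := (key z _ hm).1
          rw [qX_apply, hm1, ih'.1, Pi.zero_apply, smul_zero, add_zero] at h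
          exact (sub_eq_zero.1 h).symm
        obtain ⟨A, hA⟩ := hbΨ ks (d - (j + 1))
        obtain ⟨B, hB⟩ := hbΧ ks (d - (j + 1))
        by_cases hbks : b ks = 0
        · -- a real rate: positive shell
          refine ⟨?_, fun h => (h hbks).elim⟩
          funext y
          refine ModeRank.eq_zero_of_laplacian_eq_smul_of_pos (hcΨ _) hpos (fun z => ?_) hA y
          have h1 := kX z
          rw [hbks, zero_smul, add_zero] at h1
          exact h1
        · -- an oscillatory rate: rotating shell system
          have kY : ∀ z, (Δ (curl (Χ ks (d - (j + 1))))) z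
              = a ks • curl (Χ ks (d - (j + 1))) z - b ks • curl (Ψ ks (d - (j + 1))) z := by
            intro z
            have h := (key z _ hm).2 hbks
            rw [qY_apply, hm1, ih'.2 hbks, Pi.zero_apply, smul_zero, add_zero] at h
            exact (sub_eq_zero.1 h).symm
          have hp := eq_zero_of_laplacian_pair (hcΨ _) (hcΧ _) hpos kX kY hA hB
          exact ⟨hp.1, fun _ => hp.2⟩
    apply hks
    intro m hm
    have h := hdesc (d - m) (Nat.sub_le _ _)
    rwa [Nat.sub_sub_self hm.le] at h
  -- ### Step 4: curl-free slices ⇒ zero (KNSS gauge)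
  have hslF : ∀ s < 0, u s = fun y => ∑ p, qc d a b s p • qΦ d Ψ Χ p y :=
    fun s hs => funext (hsl' s hs)
  refine ModeRank.eq_zero_of_curl_slice_const hu fun t ht => ⟨0, fun x => ?_⟩
  rw [hslF t ht, curl_sum_smul' hdΦ]
  refine Finset.sum_eq_zero ?_
  rintro ⟨k | k, m⟩ -
  · rw [qΦ_inl, (hcar k m m.isLt).1, Pi.zero_apply, smul_zero]
  · by_cases hbk : b k = 0
    · rw [hsin0 k m hbk, zero_smul]
    · rw [qΦ_inr, (hcar k m m.isLt).2 hbk, Pi.zero_apply, smul_zero]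

/-- **Nesting inside the line**: the quasi-polynomial cell contains the complex-simple cell
`Row_A1cs` (`d = 1`). -/
theorem row_A1cs_of_row_A1qx (h : Row_A1qx) : Row_A1cs := by
  intro C u hu n a b ψ χ hb0 hinj hψ hχ hbψ hbχ hsl
  refine h C u hu n 1 a b (fun k _ => ψ k) (fun k _ => χ k) hb0 hinj (fun k _ => hψ k)
    (fun k _ => hχ k) (fun k _ => hbψ k) (fun k _ => hbχ k) ?_
  intro t ht x
  rw [hsl t ht x]
  refine Finset.sum_congr rfl fun k _ => ?_
  simp

/-- **Nesting inside the line**: the quasi-polynomial cell contains the Jordan cell `Row_A1jb`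
(one real rate, frequency zero). -/
theorem row_A1jb_of_row_A1qx (h : Row_A1qx) : Row_A1jb := by
  intro C u hu a n ψ hψ hbψ hsl
  set ψ' : Fin 1 → ℕ → E3 → E3 := fun _ m => if hm : m < n then ψ ⟨m, hm⟩ else 0 with hψ'
  have hψ'eq : ∀ k (m : Fin n), ψ' k m = ψ m := by
    intro k m
    simp only [hψ', dif_pos m.isLt, Fin.eta]
  have hψ'r : ∀ k m, ContDiff ℝ 3 (ψ' k m) := by
    intro k m
    by_cases hm : m < n
    · simp only [hψ', dif_pos hm]; exact hψ _
    · simp only [hψ', dif_neg hm]; exact contDiff_const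
  have hbψ' : ∀ k m, ∃ A : ℝ, ∀ x, ‖curl (ψ' k m) x‖ ≤ A := by
    intro k m
    by_cases hm : m < n
    · simp only [hψ', dif_pos hm]; exact hbψ _
    · simp only [hψ', dif_neg hm]; exact ⟨0, fun x => by rw [curl_zero x, norm_zero]⟩
  refine h C u hu 1 n (fun _ => a) (fun _ => 0) ψ' (fun _ _ => 0) (fun _ => le_rfl)
    (fun k k' _ => Subsingleton.elim k k') hψ'r (fun _ _ => contDiff_const) hbψ'
    (fun _ _ => ⟨0, fun x => by rw [curl_zero x, norm_zero]⟩) ?_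
  intro t ht x
  rw [hsl t ht x, Finset.smul_sum]
  simp only [Finset.univ_unique, Fin.default_eq_zero, Fin.isValue, Finset.sum_singleton, zero_mul,
    Real.cos_zero, one_smul, Real.sin_zero, zero_smul, add_zero, smul_smul]
  have e : ∑ m : Fin n, (Real.exp (a * t) * t ^ (m : ℕ)) • ψ' 0 m x
      = ∑ m ∈ Finset.range n, (Real.exp (a * t) * t ^ m) • ψ' 0 m x :=
    Fin.sum_univ_eq_sum_range (fun m => (Real.exp (a * t) * t ^ m) • ψ' 0 m x) n
  rw [← e]
  refine Finset.sum_congr rfl fun m _ => ?_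
  rw [hψ'eq 0 m]

/-- Bookkeeping (REV 3): the six decided temporal-spectrum cells of this line. -/
theorem temporalSpectrum_cells_decided₆ :
    Row_A1ex ∧ Row_A1po ∧ Row_A1cx ∧ Row_A1jb ∧ Row_A1cs ∧ Row_A1qx :=
  ⟨row_A1ex_holds, row_A1po_holds, row_A1cx_holds, row_A1jb_holds, row_A1cs_holds, row_A1qx_holds⟩

end Summit.NavierStokesRegularity.NavierStokesRegularity.Theorems.ScenarioCensus.TemporalSpectrum

end
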